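import Summits.BirchSwinnertonDyer.BirchSwinnertonDyer.Theorems.KatoDescentPotSupersingularReducibleKatoMemberOfFineInputsCharForm
import Literature.NumberTheory.IwasawaTheory.ClassicalMuVanishesUnramifiedClassesProofs
import Literature.NumberTheory.IwasawaTheory.ClassNumberPExpZeroCyclotomicSubfield
import HarnessLib

/-!
# Coates–Sujatha's statement (A) on REDUCIBLE rows WITHOUT Ferrero–Washington: from the Iwasawa-1956 data of
# the Borel field (per-row door), and FACT-FREE on the cyclotomic-Borel rows (`ℚ(χ₁, χ₂) ⊆ ℚ(μ_p)`, `p ∤ h(ℚ(μ_p))`;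
# nothing displayed at `p = 3, 5`)

Seat `bsd-potss-rkm` g35 (prover; cell `bsd-potss`, HOME `run/shared/lean/pub/bsd-potss/`), item
stmt-BirchSwinnertonDyer-19196 `ReducibleKatoMember` = crux M of the routes K9 `KatoDescentPotSupersingular` /
K8-t′ `KatoDescentTamePotSupersingular` (`--supports`, helper; closes nothing).  HONEST FRAMING (cell): BSD is not
proved by any of this; nothing is booked; crux M stays cite-level on the ledger; the class-wide trust base of M is
UNCHANGED ({modularity, Fine, H2X⁺, FW}) — what changes is the trust base ON A SUB-CLASS OF ROWS.

WHY.  After g34, Ferrero–Washington is the only classical named fact left under crux M, and it is consumed at exactly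
one place: `ReducibleFineSelmerMuZeroCharForm.fineSelmerInfty_torsion_finite_of_reducible` (g33) needs
`ClassicalMuVanishes` for the cyclotomic `ℤ_p`-tower of the Borel field `K(χ₁, χ₂) = W.borelField C` of the stable line
`C`.  That input is a KERNEL THEOREM in two situations, both without FW:

* (ROW DOOR) when `p ∤ h(K(χ₁, χ₂))` and `K(χ₁, χ₂)` has exactly one prime above `p` — Iwasawa 1956 / Greenberg
  Prop. 2.1, DISCHARGED in the tree (`iwasawa1956_…_holds`); displayed as two integers of the (abelian, degree
  `∣ (p-1)²`) Borel field, FINER than the division-field door `DivisionFieldClassNumberDoor` of the U₀ lanes (which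
  reads the same two integers on the whole `ℚ(E[p]) ⊇ ℚ(χ₁, χ₂)`);
* (CYCLOTOMIC-BOREL ROWS) when `ℚ(χ₁, χ₂) ⊆ ℚ(μ_p)` (semisimplification `ωᵃ ⊕ ω^{1-a}`; at `p = 3`: the isogeny
  character is trivial or cyclotomic, e.g. a rational `3`-torsion point with cyclotomic quotient) and `p ∤ h(ℚ(μ_p))`
  (`p` regular) — Greenberg 2001 p. 342 + prime-to-`p` descent, the Literature file
  `IwasawaTheory/ClassNumberPExpZeroCyclotomicSubfield` (this seat, theorem-only); at `p = 3, 5` the class number is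
  `1` in Mathlib, so NOTHING is displayed.

Consequence for crux M on those rows: statement (A) — hence `μ(J.H2) = 0` and the core package per pin
(`FineInputsCharForm.nonempty_coreInputs_of_fineInputs_of_moduleFinite`, g33) — no longer cites FW; the remaining
inputs there are {modularity, `exists_memberHullZetaFineInputs`, `exists_iwasawaH2Data_fineSelmerDual_embedding_count`}
(Kato's Euler system and modularity only), AT THE MEMBER the package is read at.

* `fineSelmerInfty_torsion_finite_of_reducible_of_borelField_iwasawa1956` — any number field `K`, `p` odd, `κ`
  cyclotomic, `C` a stable line: `Sel₀(K_∞, E[p])` finite from `p ∤ #Cl(𝓞 K(χ₁,χ₂))` + one prime above `p`. FACT-FREE.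
* `fineSelmerDual_moduleFinite_of_borelField_iwasawa1956` — `K = ℚ`, the (A) spelling of crux M's chain. FACT-FREE.
* `fineSelmerDual_moduleFinite_of_borelField_le_cyclotomic` — `K = ℚ`, `W.borelField C ≤ L` for a `p`-th cyclotomic
  `L ⊆ ℚ̄`, `p ∤ #Cl(𝓞 L)`: (A). FACT-FREE (regularity displayed).
* `fineSelmerDual_moduleFinite_of_borelField_le_cyclotomic_three` / `_five` — NOTHING displayed.
* `nonempty_coreInputs_of_fineInputs_of_borelField_le_cyclotomic_three` — per pin at a cyclotomic-Borel row at `p = 3`: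
  Kato's core package from the hull sub-package `Z`, H2X⁺'s `(J, e_X, count)` and NOTHING ELSE (g33's assembly with (A)
  supplied here).

NOT done here (recorded for the successor): the bridge «rational `p`-torsion point generating `C` ⟹
`W.borelField C ≤ ℚ(μ_p)`» needs `det ρ̄ = ω` on `E[p]` (tree: `det_galoisRepTorsion_eq_toZMod_det_galoisRepTate`,
`det_galoisRepTate_eq_cyclotomicCharacter`); with it the `p = 3` statement becomes class-wide on the 3-torsion family.

References: [Greenberg2001IwasawaPastPresent] Prop. 2.1 (p. 339), p. 342; [Washington1997] Thm. 10.4, Prop. 13.22;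
[NeukirchANT1999] III (1.6) (ii); [CoatesSujatha2005] Thm. 3.4, Cor. 3.6; [Wuthrich2014] Lemma 14 (p. 396);
[Kato2004Asterisque] Thm. 12.5 (pp. 221–222), §14.14 (p. 243).
-/

-- the summit and its single problem are both named `BirchSwinnertonDyer` (registry layout D-0017)
set_option linter.dupNamespace false
set_option autoImplicit false

noncomputable section

open scoped Classical NumberField

namespace Summit.BirchSwinnertonDyer.BirchSwinnertonDyer.Theorems.ReducibleFineSelmerBorelCyclotomic

open NumberField IsDedekindDomain Field WeierstrassCurve IntermediateField
open Literature.NumberTheory.EllipticCurves Literature.NumberTheory.EllipticCurves.GreenbergSelmer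
  Literature.NumberTheory.EllipticCurves.FineSelmerTrivialisingRestriction
  Literature.NumberTheory.GaloisRepresentations Literature.NumberTheory.IwasawaTheory
  Literature.NumberTheory.EllipticCurves.Kato2004 Literature.NumberTheory.EllipticCurves.IwasawaAlgebra
  Summit.BirchSwinnertonDyer.BirchSwinnertonDyer.Theorems

/-! ## §1 The ROW DOOR: (A) on a reducible row from the Iwasawa-1956 data of the Borel field — fact-free -/

/-- **`Sel₀(K_∞, E[p])` is finite on a reducible row whose Borel field satisfies Iwasawa's 1956 criterion — FACT-FREE.**
`K` a number field, `E/K` elliptic, `p` odd, `κ` the cyclotomic `ℤ_p`-extension, `C ≤ E[p]` a `Γ_K`-stable line; if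
`p ∤ #Cl(𝓞 K(χ₁,χ₂))` and `K(χ₁,χ₂) = W.borelField C` has exactly one prime above `p`, then `Sel₀(K_∞, E[p])` is finite:
g33's dévissage `fineSelmerInfty_torsion_finite_of_reducible` with its two inputs DISCHARGED — the character form of
`μ = 0` by `classicalMuVanishes_finite_unramifiedClasses_holds` (g34) and `ClassicalMuVanishes` of the Borel tower by
`iwasawa1956_…_holds` (Greenberg Prop. 2.1: `λ = μ = ν = 0`).  No Ferrero–Washington.
[cite: Greenberg2001IwasawaPastPresent, Prop. 2.1 p. 339] [cite: CoatesSujatha2005, Cor. 3.6 (proof)]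
[cite: Wuthrich2014, Lemma 14 (p. 396)] -/
theorem fineSelmerInfty_torsion_finite_of_reducible_of_borelField_iwasawa1956
    {K : Type} [Field K] [NumberField K] (W : WeierstrassCurve K) [W.IsElliptic]
    {p : ℕ} [Fact p.Prime] (hp : p ≠ 2) (κ : ZpExtension K p) (hκ : κ.IsCyclotomic)
    (C : AddSubgroup (W.geomTorsion (p : ℤ)))
    (hC : ∀ (σ : absoluteGaloisGroup K) (x : W.geomTorsion (p : ℤ)), x ∈ C → σ • x ∈ C)
    (h1 : C ≠ ⊥) (h2 : C ≠ ⊤)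
    (hh : ¬ p ∣ Nat.card (ClassGroup (𝓞 ↥(W.borelField C))))
    (hv : ∃! v : HeightOneSpectrum (𝓞 ↥(W.borelField C)), ((p : ℕ) : 𝓞 ↥(W.borelField C)) ∈ v.asIdeal) :
    (fineSelmerInfty (↥(W.geomTorsion (p : ℤ))) κ :
      Set (subgroupH1 κ.kerSubgroup (W.geomTorsion (p : ℤ)))).Finite := by
  have hpr : p.Prime := Fact.out
  haveI : NeZero p := ⟨hpr.ne_zero⟩
  haveI : FiniteDimensional K (W.borelField C) := finiteDimensional_borelField C
  haveI : NumberField (W.borelField C) := NumberField.of_module_finite K _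
  have hh' : ¬ p ∣ NumberField.classNumber ↥(W.borelField C) := by
    rwa [NumberField.classNumber, ← Nat.card_eq_fintype_card]
  refine ReducibleFineSelmerMuZeroCharForm.fineSelmerInfty_torsion_finite_of_reducible
    Literature.NumberTheory.IwasawaTheory.classicalMuVanishes_finite_unramifiedClasses_holds
    W hp κ hκ C hC h1 h2 fun κF _ => ?_
  exact classicalMuVanishes_of_classNumberPExp_eq_zero
    iwasawa1956_classNumberPExp_eq_zero_of_not_dvd_classNumber_of_unique_prime_holds hh' hv κF

/-- **Statement (A) on a reducible row of `E/ℚ` from the Iwasawa-1956 data of the Borel field — FACT-FREE** (the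
spelling `∃ γ D, Module.Finite ℤ_[p] D.X` consumed by crux M's chain; byte-identical conclusion with g34's
`FineInputsFW.fineSelmerDual_moduleFinite_of_not_irreducible_of_FW`, whose input was Ferrero–Washington).  Inputs: `p`
odd, `C` a stable line of `E[p]`, `p ∤ #Cl(𝓞 ℚ(χ₁,χ₂))`, one prime of `ℚ(χ₁,χ₂)` above `p`; Lim–Sujatha bricks
for the spelling. [cite: Greenberg2001IwasawaPastPresent, Prop. 2.1 p. 339] [cite: CoatesSujatha2005, Cor. 3.6]
[cite: Wuthrich2014, Lemma 14 (p. 396)] -/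
theorem fineSelmerDual_moduleFinite_of_borelField_iwasawa1956
    (W : WeierstrassCurve ℚ) [W.IsElliptic] (p : ℕ) [Fact p.Prime] (hp : p ≠ 2)
    (κ : ZpExtension ℚ p) (hκ : κ.IsCyclotomic)
    (C : AddSubgroup (W.geomTorsion (p : ℤ)))
    (hC : ∀ (σ : absoluteGaloisGroup ℚ) (x : W.geomTorsion (p : ℤ)), x ∈ C → σ • x ∈ C)
    (h1 : C ≠ ⊥) (h2 : C ≠ ⊤)
    (hh : ¬ p ∣ Nat.card (ClassGroup (𝓞 ↥(W.borelField C))))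
    (hv : ∃! v : HeightOneSpectrum (𝓞 ↥(W.borelField C)), ((p : ℕ) : 𝓞 ↥(W.borelField C)) ∈ v.asIdeal) :
    ∃ (γ : Field.absoluteGaloisGroup ℚ) (D : W.FineSelmerDualData κ γ),
      Module.Finite ℤ_[p] (RestrictScalars ℤ_[p] (IwasawaAlgebra p) D.X) := by
  have hpr : p.Prime := Fact.out
  haveI : NeZero p := ⟨hpr.ne_zero⟩
  rw [LimSujatha2018.fineSelmerDual_moduleFinite_iff_finite_fineSelmerInfty_torsion W hp κ hκ]
  exact fineSelmerInfty_torsion_finite_of_reducible_of_borelField_iwasawa1956 W hp κ hκ C hC h1 h2 hh hv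

/-! ## §2 The CYCLOTOMIC-BOREL rows: `ℚ(χ₁, χ₂) ⊆ ℚ(μ_p)`, `p ∤ h(ℚ(μ_p))` — fact-free; nothing displayed at `p = 3, 5` -/

/-- **Statement (A) on a cyclotomic-Borel row — FACT-FREE, regularity displayed.**  `E/ℚ`, `p` odd, `κ` cyclotomic, `C` a
stable line of `E[p]` whose Borel field lies in a `p`-th cyclotomic subfield `L ⊆ ℚ̄` (`W.borelField C ≤ L`), and
`p ∤ #Cl(𝓞 L)`: then (A) holds at `(E, p)`.  The `μ = 0` input of the dévissage is
`classicalMuVanishes_of_isCyclotomic_of_algHom_cyclotomic` (Iwasawa 1956 at `L` + prime-to-`p` descent along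
`ℚ(χ₁,χ₂) ⊆ L`, `[L : ℚ] = p - 1`). [cite: Greenberg2001IwasawaPastPresent, Prop. 2.1 p. 339 and p. 342]
[cite: NeukirchANT1999, Ch. III §1 Prop. (1.6) (ii)] [cite: CoatesSujatha2005, Cor. 3.6] [cite: Wuthrich2014, Lemma 14 (p. 396)] -/
theorem fineSelmerDual_moduleFinite_of_borelField_le_cyclotomic
    (W : WeierstrassCurve ℚ) [W.IsElliptic] (p : ℕ) [Fact p.Prime] (hp : p ≠ 2)
    (κ : ZpExtension ℚ p) (hκ : κ.IsCyclotomic)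
    (C : AddSubgroup (W.geomTorsion (p : ℤ)))
    (hC : ∀ (σ : absoluteGaloisGroup ℚ) (x : W.geomTorsion (p : ℤ)), x ∈ C → σ • x ∈ C)
    (h1 : C ≠ ⊥) (h2 : C ≠ ⊤)
    (L : IntermediateField ℚ (AlgebraicClosure ℚ)) [IsCyclotomicExtension {p} ℚ L]
    (hB : W.borelField C ≤ L) (hreg : ¬ p ∣ Nat.card (ClassGroup (𝓞 L))) :
    ∃ (γ : Field.absoluteGaloisGroup ℚ) (D : W.FineSelmerDualData κ γ),
      Module.Finite ℤ_[p] (RestrictScalars ℤ_[p] (IwasawaAlgebra p) D.X) := by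
  have hpr : p.Prime := Fact.out
  haveI : NeZero p := ⟨hpr.ne_zero⟩
  rw [LimSujatha2018.fineSelmerDual_moduleFinite_iff_finite_fineSelmerInfty_torsion W hp κ hκ]
  haveI : FiniteDimensional ℚ (W.borelField C) := finiteDimensional_borelField C
  haveI : NumberField (W.borelField C) := NumberField.of_module_finite ℚ _
  haveI : NumberField L := IsCyclotomicExtension.numberField {p} ℚ L
  have hreg' : ¬ p ∣ NumberField.classNumber ↥L := by
    rwa [NumberField.classNumber, ← Nat.card_eq_fintype_card]
  refine ReducibleFineSelmerMuZeroCharForm.fineSelmerInfty_torsion_finite_of_reducible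
    Literature.NumberTheory.IwasawaTheory.classicalMuVanishes_finite_unramifiedClasses_holds
    W hp κ hκ C hC h1 h2 fun κF hκF => ?_
  exact classicalMuVanishes_of_isCyclotomic_of_algHom_cyclotomic p ↥(W.borelField C) ↥L
    (IntermediateField.inclusion hB) hreg' κF hκF

/-- **Statement (A) on a cyclotomic-Borel row at `p = 3` — NOTHING displayed** (`h(ℚ(μ_3)) = 1`, Mathlib `three_pid`): every
`E/ℚ` with a `Γ_ℚ`-stable line `C ≤ E[3]` whose Borel field lies in a third cyclotomic subfield `L ⊆ ℚ̄` (the isogeny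
character of `C` is trivial or cyclotomic AND so is the quotient character) satisfies (A) at `3` for every cyclotomic
`ℤ_3`-extension. [cite: Greenberg2001IwasawaPastPresent, Prop. 2.1 p. 339 and p. 342] [cite: CoatesSujatha2005, Cor. 3.6]
[cite: Wuthrich2014, Lemma 14 (p. 396)] -/
theorem fineSelmerDual_moduleFinite_of_borelField_le_cyclotomic_three
    (W : WeierstrassCurve ℚ) [W.IsElliptic] [Fact (3 : ℕ).Prime]
    (κ : ZpExtension ℚ 3) (hκ : κ.IsCyclotomic)
    (C : AddSubgroup (W.geomTorsion ((3 : ℕ) : ℤ)))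
    (hC : ∀ (σ : absoluteGaloisGroup ℚ) (x : W.geomTorsion ((3 : ℕ) : ℤ)), x ∈ C → σ • x ∈ C)
    (h1 : C ≠ ⊥) (h2 : C ≠ ⊤)
    (L : IntermediateField ℚ (AlgebraicClosure ℚ)) [IsCyclotomicExtension {3} ℚ L]
    (hB : W.borelField C ≤ L) :
    ∃ (γ : Field.absoluteGaloisGroup ℚ) (D : W.FineSelmerDualData κ γ),
      Module.Finite ℤ_[3] (RestrictScalars ℤ_[3] (IwasawaAlgebra 3) D.X) := by
  haveI : NumberField L := IsCyclotomicExtension.numberField {3} ℚ L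
  refine fineSelmerDual_moduleFinite_of_borelField_le_cyclotomic W 3 (by decide) κ hκ C hC h1 h2 L hB ?_
  rw [Nat.card_eq_fintype_card, ← NumberField.classNumber, classNumber_eq_one_of_isCyclotomicExtension_three ↥L]
  decide

/-- **Statement (A) on a cyclotomic-Borel row at `p = 5` — NOTHING displayed** (`h(ℚ(μ_5)) = 1`, Mathlib `five_pid`).
[cite: Greenberg2001IwasawaPastPresent, Prop. 2.1 p. 339 and p. 342] [cite: CoatesSujatha2005, Cor. 3.6]
[cite: Wuthrich2014, Lemma 14 (p. 396)] -/
theorem fineSelmerDual_moduleFinite_of_borelField_le_cyclotomic_five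
    (W : WeierstrassCurve ℚ) [W.IsElliptic] [Fact (5 : ℕ).Prime]
    (κ : ZpExtension ℚ 5) (hκ : κ.IsCyclotomic)
    (C : AddSubgroup (W.geomTorsion ((5 : ℕ) : ℤ)))
    (hC : ∀ (σ : absoluteGaloisGroup ℚ) (x : W.geomTorsion ((5 : ℕ) : ℤ)), x ∈ C → σ • x ∈ C)
    (h1 : C ≠ ⊥) (h2 : C ≠ ⊤)
    (L : IntermediateField ℚ (AlgebraicClosure ℚ)) [IsCyclotomicExtension {5} ℚ L]
    (hB : W.borelField C ≤ L) :
    ∃ (γ : Field.absoluteGaloisGroup ℚ) (D : W.FineSelmerDualData κ γ),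
      Module.Finite ℤ_[5] (RestrictScalars ℤ_[5] (IwasawaAlgebra 5) D.X) := by
  haveI : NumberField L := IsCyclotomicExtension.numberField {5} ℚ L
  refine fineSelmerDual_moduleFinite_of_borelField_le_cyclotomic W 5 (by decide) κ hκ C hC h1 h2 L hB ?_
  rw [Nat.card_eq_fintype_card, ← NumberField.classNumber, classNumber_eq_one_of_isCyclotomicExtension_five ↥L]
  decide

/-! ## §3 Crux M's core package per pin on a cyclotomic-Borel row at `p = 3`: Kato's inputs and NOTHING ELSE -/

/-- **Per pin at a cyclotomic-Borel row at `p = 3`, Kato's core package `MemberHullZetaCoreInputs` from the hull sub-package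
`Z` (Fine) and H2X⁺'s `(J, e_X, count)` — NO Ferrero–Washington, NO Lim, NO char-form fact, NO Imai** (g33's
`FineInputsCharForm.nonempty_coreInputs_of_fineInputs_of_moduleFinite` with statement (A) supplied by
`fineSelmerDual_moduleFinite_of_borelField_le_cyclotomic_three`).  The only inputs left at such a pin are the data the
two Kato facts produce. [cite: Kato2004Asterisque, Thm. 12.5 (3) (p. 222), (14.9.1) (p. 239), §14.14 (14.14.1)–(14.14.2) (p. 243)]
[cite: Greenberg2001IwasawaPastPresent, p. 342] -/
theorem nonempty_coreInputs_of_fineInputs_of_borelField_le_cyclotomic_three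
    (W : WeierstrassCurve ℚ) [W.IsElliptic] [Fact (3 : ℕ).Prime] [ContinuousSMul ℤ_[3] (W.tateModule 3)]
    {κ : ZpExtension ℚ 3} (hκ : κ.IsCyclotomic) {γ : absoluteGaloisGroup ℚ} (hγ : κ.IsTopGenerator γ)
    (C : AddSubgroup (W.geomTorsion ((3 : ℕ) : ℤ)))
    (hC : ∀ (σ : absoluteGaloisGroup ℚ) (x : W.geomTorsion ((3 : ℕ) : ℤ)), x ∈ C → σ • x ∈ C)
    (h1 : C ≠ ⊥) (h2 : C ≠ ⊤)
    (L : IntermediateField ℚ (AlgebraicClosure ℚ)) [IsCyclotomicExtension {3} ℚ L]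
    (hB : W.borelField C ≤ L)
    {I : IwasawaH1Data W 3 κ γ} {y : I.H} (Z : MemberHullZetaFineInputs W 3 κ γ hγ I y)
    (J : IwasawaH2Data W 3 κ γ I)
    (eX : (W.fineSelmerDualData κ hγ).X →ₗ[IwasawaAlgebra 3] J.H2) (heX : Function.Injective eX)
    (hcokX : Finite (J.H2 ⧸ LinearMap.range eX)) (hcount : KatoH2CountAt W 3 (Nat.card (coinvariants 3 J.H2))) :
    Nonempty (MemberHullZetaCoreInputs W 3 κ γ I y) :=
  FineInputsCharForm.nonempty_coreInputs_of_fineInputs_of_moduleFinite W 3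
    (fineSelmerDual_moduleFinite_of_borelField_le_cyclotomic_three W κ hκ C hC h1 h2 L hB) hγ Z J eX heX hcokX hcount

end Summit.BirchSwinnertonDyer.BirchSwinnertonDyer.Theorems.ReducibleFineSelmerBorelCyclotomic

end
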